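import Summits.BirchSwinnertonDyer.BirchSwinnertonDyer.Theorems.AdditiveKolyvaginRoadKolyvaginPrimitiveAdditiveRankLowering
import Summits.BirchSwinnertonDyer.BirchSwinnertonDyer.Theorems.AdditiveKolyvaginRoadLevelMembership
import HarnessLib

/-!
# Route `AdditiveKolyvaginRoad`, crux KS′ `LevelKolyvaginSystemsAdditive` (stmt-BirchSwinnertonDyer-21396) ∕ KPA′ (stmt-BirchSwinnertonDyer-21400):
# SWITCHED CANONICAL SPACES, part 1 — relaxation bookkeeping at a general relaxed set and (Iso) with an ARBITRARY isotropic condition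
# at a set `T` of switched primes (Poitou–Tate see-saw, W. Zhang Prop. 5.4)
# (cell `pub/bsd-wall`, width seat `bsd-wall-akr-p2x-w3` g10; `--supports stmt-BirchSwinnertonDyer-21396`, helper; E-side engine; part 1 of 2,
# sequel `…SwitchedRankLowering.lean`)

WHY. W. Zhang's rank lowering (Prop. 5.4 + Lemma 7.3) is in the kernel for the CANONICAL level spaces `SelQP n μ` — E's Kummer condition at every
place off the level `n`, INCLUDING the places above the additive `p` (akr-p1's A1 `stub_rankLoweringAdditive`, via the five-input reduction
`selQP_rankLowering_of_localGlobal` and `hiso_of_admQ`). Several live ideas on the crux chain KS′ ∕ KPA′ run the same induction on `E[p]` in a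
Selmer structure that DIFFERS from E's at the places above `p` (or above the bad primes): the «FL-engine» T2 of the crux-ideate card
`Cruxes/LevelKolyvaginSystemsAdditive/Ideas/irred-vertex-anchor.md` (E's Kummer LINE at `𝔭, 𝔭̄` replaced by the Fontaine–Laffaille line of a
congruent companion form), the transfer ∕ switch-at-`p` cards (`al-even-etale-shadow`, `depleted-shadow-transfer`; memo `SWITCH-AT-P.md`, whose
files built the ONE-PLACE switch but not the level machinery). This pair of files proves the rank lowering ONCE for all of them: E's Kummer
condition above a finite set `T` of naturals (coprime to the admissible primes) is DROPPED from the canonical space (relaxed set `T`, a slot the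
definition `levelSelmerSubgroupP n S μ` already has) and replaced by membership in an ARBITRARY subgroup `Λ ≤ H¹(K, E[p])`; the only input about `Λ`
is that its localisations above `T` are ISOTROPIC for the local Weil cup product (for every Weil datum on `E[p]`) — the hypothesis under which the
Poitou–Tate see-saw still makes the image at a new admissible place a LINE. No definition is introduced: the switched space is the term
`levelSelmerSubgroupP W K p c n T μ ⊓ Λ` (as a `ZMod p`-subspace through `AddSubgroup.toZModSubmodule`).

WHAT (namespace `…Theorems.AdditiveKoly`).
* §1 `levelSelmerSubgroupP_mono_relaxed` (`S ⊆ S'` ⟹ `≤`), `levelSelmerSubgroupP_le_insert_of_mem` ((A4) relaxation at a general relaxed set: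
  `q ∈ S' ⊇ S` ⟹ `level n S ≤ level (insert q n) S'`) — definitional bookkeeping, the general-`S` forms of `selRelQP_mono` ∕ `relaxationP_le`.
* §2 **`hiso_switched_of_admQ`** — (IsoΛ): `K` imaginary quadratic; `Λ` with isotropic localisations above `T` (binder `hΛ`, quantified over
  Weil data); at a Bertolini–Darmon admissible `q ∉ n` with place `v`, two classes of `levelSelmerSubgroupP (insert q n) (insert q T) μ ⊓ Λ` have
  proportional `torsionLocMap`-localisations at `v`. Proof = `hiso_of_admQ` (akr-p1 g2) with one more case in the vanishing of the local Weil
  terms off `v`: above `T` by `hΛ`; elsewhere Kummer isotropy (`cupProduct_eq_zero_of_mem_kummerSelmerStructure_of_fact` on the PROVED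
  `kummerClass_cupProduct_kummerClass_eq_zero_holds`), toric isotropy at the admissible places of `n` (`weilCupProduct_res_eq_zero_of_valued` +
  `natCard_augmentation_le_of_admQ`), then Tate reciprocity for the totally complex `K` (`Iso.exists_zsmul_localization_of_forall_ne`) and the
  plane count `#H¹(K_v, E[p]) ≤ p²` (`natCard_invariants_le_of_admQ`).

HONEST FRAMING: theorems only; 0 definitions, 0 named facts, 0 `sorry`; standard axioms. Hypotheses displayed (`hΛ`; the instance binder
`CompactSpace` of the local absolute Galois groups is needed to STATE the cup products and is supplied at any call site by
`absoluteGaloisGroup_compactSpace`). E-side glue; closes nothing: the crux's open content (Kolyvagin's conjecture mod `p` above the bottom at an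
additive `p ≥ 5`) is untouched. BSD is not proved by any of this.

References: [cite: WZhang2014, Prop. 5.4, Lemma 7.3, §9 (9.1)–(9.3)] [cite: BertoliniDarmon2005, Lemma 2.6, §2.2–§2.3, Thm. 3.2]
[cite: MilneADT2006, Ch. I, Cor. 2.3, Thm. 2.8, Thm. 4.10(b)] [cite: PoonenRains2012, Prop. 4.8, Prop. 4.10, Cor. 4.6].
-/

-- single-conjunct summit: `Summit.BirchSwinnertonDyer.BirchSwinnertonDyer.…` repeats the name by design
set_option linter.dupNamespace false

noncomputable section

open scoped Classical

namespace Summit.BirchSwinnertonDyer.BirchSwinnertonDyer.Theorems.AdditiveKoly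

open CategoryTheory WeierstrassCurve Field Function NumberField IsDedekindDomain
open Literature.NumberTheory.EllipticCurves Literature.NumberTheory.EllipticCurves.ModularForms
  Literature.NumberTheory.EllipticCurves.Rank1Residual Literature.NumberTheory.GaloisRepresentations Module
open Literature.NumberTheory.GaloisRepresentations.DiscreteGaloisModule (mu MuCarrier)
open Literature.NumberTheory.GaloisCohomology
open Summit.BirchSwinnertonDyer.Rank1Residual.X11b.Three.Koly.Method2
open scoped ContRepresentation

variable (W : WeierstrassCurve ℚ) (K : Type) [Field K] [NumberField K] (p : ℕ) (c : K ≃ₐ[ℚ] K)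

/-! ## §1 Relaxation bookkeeping for the canonical spaces at a general relaxed set -/

section Relax

/-- **Monotonicity in the relaxed set**: `S ⊆ S'` ⟹ `levelSelmerSubgroupP n S μ ≤ levelSelmerSubgroupP n S' μ` (fewer Kummer
conditions, fewer toric conditions). [cite: WZhang2014, §9 (9.3)] -/
theorem levelSelmerSubgroupP_mono_relaxed (n : Finset ℕ) {S S' : Set ℕ} (hSS' : S ⊆ S') (μ : Bool) :
    levelSelmerSubgroupP W K p c n S μ ≤ levelSelmerSubgroupP W K p c n S' μ := by
  intro x hx
  rw [mem_levelSelmerSubgroupP_iff] at hx ⊢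
  obtain ⟨hsgn, hinf, hfin, htor⟩ := hx
  refine ⟨hsgn, hinf, fun v hv ↦ hfin v fun q hq ↦ hv q ?_,
    fun q hq v hv ↦ htor q ⟨hq.1, fun h ↦ hq.2 (hSS' h)⟩ v hv⟩
  rcases hq with hq | hq
  · exact Or.inl hq
  · exact Or.inr (hSS' hq)

/-- **(A4) RELAXATION at a general relaxed set**: for `q ∈ S' ⊇ S`, `levelSelmerSubgroupP n S μ ≤ levelSelmerSubgroupP (insert q n) S' μ`
(the new level prime is relaxed upstairs, so no condition is added). [cite: WZhang2014, §9 (9.3)] -/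
theorem levelSelmerSubgroupP_le_insert_of_mem (n : Finset ℕ) {S S' : Set ℕ} (hSS' : S ⊆ S') {q : ℕ} (hqS' : q ∈ S')
    (μ : Bool) : levelSelmerSubgroupP W K p c n S μ ≤ levelSelmerSubgroupP W K p c (insert q n) S' μ := by
  intro x hx
  rw [mem_levelSelmerSubgroupP_iff] at hx ⊢
  obtain ⟨hsgn, hinf, hfin, htor⟩ := hx
  refine ⟨hsgn, hinf, fun v hv ↦ hfin v fun q' hq' ↦ hv q' ?_, fun q' hq' v hv ↦ ?_⟩
  · rcases hq' with hq' | hq'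
    · exact Or.inl (Finset.mem_coe.mpr (Finset.mem_insert_of_mem (Finset.mem_coe.mp hq')))
    · exact Or.inr (hSS' hq')
  · rcases Finset.mem_insert.mp hq'.1 with rfl | hmem
    · exact absurd hqS' hq'.2
    · exact htor q' ⟨hmem, fun h ↦ hq'.2 (hSS' h)⟩ v hv

end Relax

/-! ## §2 (Iso) for the switched spaces: Poitou–Tate isotropy with an arbitrary isotropic condition at the places of `T` -/

section Iso

variable [W.IsElliptic] [W.IsGloballyMinimal] [Fact p.Prime]
  [∀ v : Place K, CompactSpace (absoluteGaloisGroup (Place.Completion v))]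

/-- **(Iso) for the SWITCHED relaxed space** (W. Zhang Prop. 5.4, Poitou–Tate see-saw), `K` imaginary quadratic. Let `T` be a set of
naturals and `Λ ≤ H¹(K, E[p])` a subgroup whose localisations are ISOTROPIC for the local Weil cup product at every place above a member
of `T`, for every Weil datum `e` on `E[p]` (hypothesis `hΛ`). Then at a Bertolini–Darmon admissible `q ∉ n` with place `v`, the
localisations at `v` of two classes of `levelSelmerSubgroupP (insert q n) (insert q T) μ ⊓ Λ` — E's Kummer condition at the places above
no member of `n ∪ T ∪ {q}`, toric above `n ∖ T`, nothing at `q` and at `T`, and membership in `Λ` — are proportional. Proof = akr-p1 g2's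
`hiso_of_admQ` with one more case: at a place above `T` the local Weil term vanishes by `hΛ` (elsewhere: Kummer isotropy, toric isotropy at
the admissible places of `n`, and Tate's reciprocity law for the totally complex `K`). [cite: WZhang2014, Prop. 5.4, §9 (9.1)–(9.2)]
[cite: MilneADT2006, Ch. I, Thm. 4.10(b)] [cite: BertoliniDarmon2005, §2.3] [cite: PoonenRains2012, Prop. 4.10] -/
theorem hiso_switched_of_admQ (hK : IsImaginaryQuadratic K) (T : Set ℕ) (Λ : AddSubgroup (Vp W K p))
    (hΛ : ∀ (e : geomTorsion (W.baseChange K) ((p ^ 1 : ℕ) : ℤ) → geomTorsion (W.baseChange K) ((p ^ 1 : ℕ) : ℤ) → AlgebraicClosure K)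
      (hμ : ∀ S T, e S T ^ (p ^ 1) = 1)
      (hadd₁ : ∀ S₁ S₂ T, e (S₁ + S₂) T = e S₁ T * e S₂ T)
      (hadd₂ : ∀ S T₁ T₂, e S (T₁ + T₂) = e S T₁ * e S T₂)
      (hgal : ∀ (σ : absoluteGaloisGroup K) (S T : geomTorsion (W.baseChange K) ((p ^ 1 : ℕ) : ℤ)),
        σ • e S T = e (σ • S) (σ • T)),
      ∀ t ∈ T, ∀ w : HeightOneSpectrum (𝓞 K), (t : 𝓞 K) ∈ w.asIdeal → ∀ y ∈ Λ, ∀ z ∈ Λ,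
        (weilContPairingLocal (W.baseChange K) (p ^ 1) e hμ hadd₁ hadd₂ hgal (Sum.inr w)).cupProduct
          (galoisCohomology.localization ((W.baseChange K).torsionGaloisModule ((p ^ 1 : ℕ) : ℤ)) (Sum.inr w) 1 y)
          (galoisCohomology.localization ((W.baseChange K).torsionGaloisModule ((p ^ 1 : ℕ) : ℤ)) (Sum.inr w) 1 z)
          = 0) :
    ∀ (n : Finset (AdmQ W K p)) (q : AdmQ W K p) (μ : Bool),
      q ∉ n → ∀ v : HeightOneSpectrum (𝓞 K), ((q : ℕ) : 𝓞 K) ∈ v.asIdeal →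
      ∀ y ∈ levelSelmerSubgroupP W K p c (insert (q : ℕ) (n.image Subtype.val)) (insert (q : ℕ) T) μ ⊓ Λ,
      ∀ z ∈ levelSelmerSubgroupP W K p c (insert (q : ℕ) (n.image Subtype.val)) (insert (q : ℕ) T) μ ⊓ Λ,
        (W.baseChange K).torsionLocMap (v.adicCompletion K) ((p ^ 1 : ℕ) : ℤ) z ≠ 0 →
        ∃ a : ℤ, (W.baseChange K).torsionLocMap (v.adicCompletion K) ((p ^ 1 : ℕ) : ℤ) y =
          a • (W.baseChange K).torsionLocMap (v.adicCompletion K) ((p ^ 1 : ℕ) : ℤ) z := by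
  intro n q μ hqn v hv y hy z hz hz0
  have hp : p.Prime := Fact.out
  haveI : IsTotallyComplex K := hK.2
  haveI : Fact (Nat.Prime (p ^ 1)) := ⟨by rw [pow_one]; exact hp⟩
  haveI : PerfectField K := PerfectField.ofCharZero
  haveI hcs : ∀ (L : Type) [Field L], CompactSpace (absoluteGaloisGroup L) :=
    fun L _ ↦ @absoluteGaloisGroup_compactSpace L _
  haveI : Finite (geomTorsion (W.baseChange K) ((p ^ 1 : ℕ) : ℤ)) :=
    finite_geomTorsion_of_neZero (W.baseChange K) (p ^ 1)
  have hpZ : ((p ^ 1 : ℕ) : ℤ) ≠ 0 := by exact_mod_cast pow_ne_zero 1 hp.ne_zero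
  obtain ⟨e, hμ, hadd₁, hadd₂, halt, hnondeg, hgal⟩ :=
    exists_weilPairing_holds (W.baseChange K) (p ^ 1) (by rw [pow_one]; exact hp.two_le) (by
      rw [pow_one]; exact_mod_cast hp.ne_zero)
  -- the place above the inert prime `q` is unique
  have hq0 : (q : ℕ) ≠ 0 := q.2.1.ne_zero
  have hqP : (Ideal.span {((q : ℕ) : 𝓞 K)}).IsPrime := q.2.2.2.1
  have huniq : ∀ w : HeightOneSpectrum (𝓞 K), ((q : ℕ) : 𝓞 K) ∈ w.asIdeal → w = v :=
    fun w hw ↦ placesAbove_eq_of_isPrime_span K hqP hq0 hv hw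
  -- `v ∤ p`
  have hpv : ((p ^ 1 : ℕ) : 𝓞 K) ∉ v.asIdeal := by
    have h := (hasGoodReductionAt_of_isAdmissiblePrime W K q.2 v hv).2
    rw [Int.cast_natCast] at h
    rw [Nat.pow_one]
    exact h
  -- `#H¹(K_v, E[p]) ≤ p²`
  have hcard := Iso.natCard_galoisCohomology_one_torsion_le_sq (W.baseChange K) (p ^ 1) v hpv
    (natCard_invariants_le_of_admQ W K p hK.1 q v hv)
  -- the comparison `Φ ∘ loc_v = torsionLocMap` between the two models of `H¹(K_v, E[p])`
  obtain ⟨Φ, hΦ⟩ := Iso.exists_addMonoidHom_comp_localization_eq_torsionLocMap (W.baseChange K) (p ^ 1) v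
  -- the switched relaxed space, as a subgroup
  set A : AddSubgroup (Vp W K p) :=
    levelSelmerSubgroupP W K p c (insert (q : ℕ) (n.image Subtype.val)) (insert (q : ℕ) T) μ ⊓ Λ with hA_def
  -- membership, unpacked
  have hmem : ∀ x ∈ A,
      x ∈ Λ ∧
      (∀ w : InfinitePlace K,
        x ∈ selmerLocalKer (W.baseChange K) w.Completion ((p ^ 1 : ℕ) : ℤ)) ∧
      (∀ w : HeightOneSpectrum (𝓞 K), (∀ q' ∈ insert q n, ((q' : ℕ) : 𝓞 K) ∉ w.asIdeal) →
        (∀ t ∈ T, (t : 𝓞 K) ∉ w.asIdeal) →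
        x ∈ selmerLocalKer (W.baseChange K) (w.adicCompletion K) ((p ^ 1 : ℕ) : ℤ)) ∧
      (∀ q' ∈ n, (q' : ℕ) ∉ T → ∀ w : HeightOneSpectrum (𝓞 K), ((q' : ℕ) : 𝓞 K) ∈ w.asIdeal →
        x ∈ toricLocalKer (W.baseChange K) (w.adicCompletion K) ((p ^ 1 : ℕ) : ℤ)) := by
    intro x hx
    obtain ⟨hx, hxΛ⟩ := AddSubgroup.mem_inf.mp hx
    rw [mem_levelSelmerSubgroupP_iff] at hx
    obtain ⟨-, hinf, hfin, hord⟩ := hx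
    refine ⟨hxΛ, hinf, fun w hw hwT ↦ hfin w fun q'' hq'' ↦ ?_, fun q' hq' hq'T w hw ↦ hord q' ⟨?_, ?_⟩ w hw⟩
    · rcases hq'' with hq'' | hq''
      · rw [Finset.mem_coe, Finset.mem_insert] at hq''
        rcases hq'' with rfl | hq''
        · exact hw q (Finset.mem_insert_self _ _)
        · rw [Finset.mem_image] at hq''
          obtain ⟨a, ha, rfl⟩ := hq''
          exact hw a (Finset.mem_insert_of_mem ha)
      · rcases Set.mem_insert_iff.mp hq'' with rfl | hq''
        · exact hw q (Finset.mem_insert_self _ _)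
        · exact hwT q'' hq''
    · exact Finset.mem_insert_of_mem (Finset.mem_image.mpr ⟨q', hq', rfl⟩)
    · intro h
      rcases Set.mem_insert_iff.mp h with h | h
      · exact hqn ((show q' = q from Subtype.ext h) ▸ hq')
      · exact hq'T h
  -- the local Weil terms of two classes of `A` vanish at every place `w ≠ v`
  have hA : ∀ y ∈ A, ∀ z ∈ A, ∀ w : Place K, w ≠ Sum.inr v →
      (weilContPairingLocal (W.baseChange K) (p ^ 1) e hμ hadd₁ hadd₂ hgal w).cupProduct
        (galoisCohomology.localization ((W.baseChange K).torsionGaloisModule ((p ^ 1 : ℕ) : ℤ)) w 1 y)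
        (galoisCohomology.localization ((W.baseChange K).torsionGaloisModule ((p ^ 1 : ℕ) : ℤ)) w 1 z)
        = 0 := by
    intro y hy z hz w hw
    obtain ⟨hyΛ, hyinf, hyfin, hyord⟩ := hmem y hy
    obtain ⟨hzΛ, hzinf, hzfin, hzord⟩ := hmem z hz
    -- Kummer isotropy at a place where both classes satisfy the Kummer condition
    have hKum : ∀ w : Place K,
        y ∈ selmerLocalKer (W.baseChange K) (Place.Completion w) ((p ^ 1 : ℕ) : ℤ) →
        z ∈ selmerLocalKer (W.baseChange K) (Place.Completion w) ((p ^ 1 : ℕ) : ℤ) →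
        (weilContPairingLocal (W.baseChange K) (p ^ 1) e hμ hadd₁ hadd₂ hgal w).cupProduct
          (galoisCohomology.localization ((W.baseChange K).torsionGaloisModule ((p ^ 1 : ℕ) : ℤ)) w 1 y)
          (galoisCohomology.localization ((W.baseChange K).torsionGaloisModule ((p ^ 1 : ℕ) : ℤ)) w 1 z)
          = 0 := by
      intro w hyw hzw
      rw [← comap_localization_kummerSelmerStructure] at hyw hzw
      exact (W.baseChange K).cupProduct_eq_zero_of_mem_kummerSelmerStructure_of_fact (p ^ 1) e hpZ w
        (kummerClass_cupProduct_kummerClass_eq_zero_holds _) hμ hadd₁ hadd₂ halt hgal hyw hzw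
    rcases w with w | w
    · -- infinite place: Kummer on both sides
      exact hKum (Sum.inl w) (hyinf w) (hzinf w)
    · have hwv : w ≠ v := fun h ↦ hw (by rw [h])
      by_cases hT : ∃ t ∈ T, (t : 𝓞 K) ∈ w.asIdeal
      · -- a member of `T` below `w`: the switched condition `Λ` is isotropic there
        obtain ⟨t, ht, htw⟩ := hT
        exact hΛ e hμ hadd₁ hadd₂ hgal t ht w htw y hyΛ z hzΛ
      · push Not at hT
        by_cases hex : ∃ q' ∈ insert q n, ((q' : ℕ) : 𝓞 K) ∈ w.asIdeal
        · -- a level prime below `w`: it is in `n` (the place of `q` is `v`) and not in `T`; both classes are toric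
          obtain ⟨q', hq', hq'w⟩ := hex
          rcases Finset.mem_insert.mp hq' with rfl | hq'n
          · exact absurd (huniq w hq'w) hwv
          · have hq'T : (q' : ℕ) ∉ T := fun h ↦ hT q' h hq'w
            exact weilCupProduct_res_eq_zero_of_valued (W.baseChange K) (p ^ 1) (w.adicCompletion K)
              e hμ hadd₁ hadd₂ hgal _
              (fun S hS T' hT' ↦ weilPairingHom_eq_zero_of_mem_of_card_le (W.baseChange K) (p ^ 1)
                e hμ hadd₁ hadd₂ halt _ (natCard_augmentation_le_of_admQ W K p hK.1 q' w hq'w) S T' hS hT')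
              (exists_valued_cocycle_of_mem_toricLocalKer (W.baseChange K) (p ^ 1) (w.adicCompletion K)
                (hyord q' hq'n hq'T w hq'w))
              (exists_valued_cocycle_of_mem_toricLocalKer (W.baseChange K) (p ^ 1) (w.adicCompletion K)
                (hzord q' hq'n hq'T w hq'w))
        · -- no level prime and no member of `T` below `w`: Kummer on both sides
          push Not at hex
          exact hKum (Sum.inr w) (hyfin w hex hT) (hzfin w hex hT)
  -- Poitou–Tate at `v`
  have hz0' : galoisCohomology.localization ((W.baseChange K).torsionGaloisModule ((p ^ 1 : ℕ) : ℤ))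
      (Sum.inr v) 1 z ≠ 0 := fun h ↦ hz0 (by rw [← hΦ z, h]; exact map_zero Φ)
  obtain ⟨a, ha⟩ := Iso.exists_zsmul_localization_of_forall_ne (W.baseChange K) (p ^ 1) e hμ hadd₁ hadd₂ hgal
    v hnondeg hcard A hA hy hz hz0'
  exact ⟨a, by rw [← hΦ y, ← hΦ z, ha]; exact map_zsmul Φ a _⟩

end Iso

end Summit.BirchSwinnertonDyer.BirchSwinnertonDyer.Theorems.AdditiveKoly

end
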